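import Literature.MathematicalPhysics.QuantumLattice.FinDimSpectrumProofs
import Literature.MathematicalPhysics.QuantumLattice.FermionGammaFunctorTrace
import Literature.MathematicalPhysics.QuantumLattice.HubbardOneParticleCost
import Literature.MathematicalPhysics.QuantumLattice.HubbardModelGrandCanonicalProofs
import Literature.MathematicalPhysics.QuantumLattice.HubbardAtomicLimit
import HarnessLib

/-!
# The parity-twisted partition function as a sector sum; diagonal Gibbs bounds (band bottom, part 5)

Topic `Literature/MathematicalPhysics/QuantumLattice` (sub-namespace `HubbardBandBottom`). Written for
route `HubbardSuperconductivity/ParityLeeYang`, support `BandBottomOnAxis` (stmt-HubbardSuperconductivity-8386).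

Finite-dimensional bookkeeping for `Z_P(β, μ) = Tr[P e^{-β(H - μN)}]`, `P = parityOp`,
`H = hamiltonian G 1 U`:

* `parity_trace_eq_sum` — `Z_P = Σ_s (-1)^{|s|} e^{βμ|s|} (e^{-βH})_{ss}` (`[H, N] = 0`);
* `gibbsWeight_apply_empty_empty` — `(e^{-βH})_{∅∅} = 1`;
* `exp_mulVec_of_mulVec_eq_smul` — eigenvectors of `A` are eigenvectors of `e^{A}`;
* `re_rayleigh_le_sum_re_diag` — Cauchy–Schwarz compression: for `X ≥ 0` and a unit vector `v`
  supported in `T`, `Re ⟨v, X v⟩ ≤ Σ_{s ∈ T} Re X_{ss}`;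
* `re_gibbsWeight_apply_self_le_one` — for `X ≥ 0` and `β ≥ 0`, `Re (e^{-βX})_{ss} ≤ 1`;
* `star_dotProduct_mulVec_eq_sum_sectors`, `re_rayleigh_add_diagonal_nonneg` — the quadratic form of
  a particle-number preserving matrix splits over the sectors, so sector-wise lower bounds
  `Re ⟨φ, H φ⟩ ≥ m(N) ‖φ‖²` make `H + diag(-m(|s|))` a nonnegative form.

Everything is proved; no definitions. Sources: Bratteli–Robinson II §5.3.1 (Gibbs states of
matrices); Reed–Simon IV §XIII.1 (variational principle).
-/

namespace Literature.MathematicalPhysics.QuantumLattice.HubbardBandBottom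

open Matrix Finset Literature.MathematicalPhysics.QuantumLattice
  Literature.MathematicalPhysics.QuantumLattice.RayleighBound NormedSpace
open scoped ComplexOrder MatrixOrder Matrix.Norms.L2Operator

section MatrixGeneric

variable {n : Type*} [Fintype n] [DecidableEq n]

/-- `exp (c • 1) = e^c • 1` for matrices (exponential of a scalar matrix). [folklore] -/
theorem exp_smul_one_eq (c : ℂ) : exp (c • (1 : Matrix n n ℂ)) = Complex.exp c • (1 : Matrix n n ℂ) := by
  have h1 : c • (1 : Matrix n n ℂ) = diagonal (fun _ => c) := by
    ext i j
    by_cases h : i = j <;> simp [h]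
  have h2 : Complex.exp c • (1 : Matrix n n ℂ) = diagonal (fun _ => Complex.exp c) := by
    ext i j
    by_cases h : i = j <;> simp [h]
  rw [h1, h2, Matrix.exp_diagonal]
  congr 1
  funext i
  rw [Pi.coe_exp, Complex.exp_eq_exp_ℂ]

/-- **Eigenvectors of `A` are eigenvectors of `e^{A}`**: `A v = c v ⟹ e^{A} v = e^{c} v`
(shift by the scalar `c`, which commutes with everything, and `e^{A - c} v = v`). [folklore] -/
theorem exp_mulVec_of_mulVec_eq_smul {ι : Type*} [LinearOrder ι] [Fintype ι]
    {A : Matrix (Finset ι) (Finset ι) ℂ} {v : Fock ι} {c : ℂ} (h : A *ᵥ v = c • v) :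
    exp A *ᵥ v = Complex.exp c • v := by
  have hsplit : A = c • (1 : Matrix (Finset ι) (Finset ι) ℂ) + (A - c • 1) := by abel
  have hcomm : Commute (c • (1 : Matrix (Finset ι) (Finset ι) ℂ)) (A - c • 1) :=
    (Commute.one_left _).smul_left c
  have h0 : (A - c • 1) *ᵥ v = 0 := by
    rw [sub_mulVec, h, smul_mulVec, one_mulVec, sub_self]
  rw [hsplit, Matrix.exp_add_of_commute _ _ hcomm, ← mulVec_mulVec,
    exp_mulVec_eq_self_of_mulVec_eq_zero _ _ h0, exp_smul_one_eq, smul_mulVec, one_mulVec]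

/-- **Cauchy–Schwarz compression.** For a positive semidefinite `X` and a unit vector `v`
supported in `T`: `Re ⟨v, X v⟩ ≤ Σ_{s ∈ T} Re X_{ss}` (write `X = B⋆B`; then
`‖B v‖² ≤ Σ_{s ∈ T} ‖B e_s‖²`). [folklore] -/
theorem re_rayleigh_le_sum_re_diag {X : Matrix n n ℂ} (hX : X.PosSemidef) (T : Finset n)
    {v : n → ℂ} (hvT : ∀ s, s ∉ T → v s = 0) (hv : star v ⬝ᵥ v = 1) :
    (star v ⬝ᵥ (X *ᵥ v)).re ≤ ∑ s ∈ T, (X s s).re := by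
  obtain ⟨B, hB⟩ := CStarAlgebra.nonneg_iff_eq_star_mul_self.mp (Matrix.nonneg_iff_posSemidef.mpr hX)
  rw [star_eq_conjTranspose] at hB
  -- `⟨v, X v⟩ = ‖B v‖²` and `X_ss = ‖B e_s‖²`
  have hnormv : ∑ s ∈ T, ‖v s‖ ^ 2 = 1 := by
    have h1 : ∑ s, ‖v s‖ ^ 2 = 1 := by
      have := congrArg Complex.re hv
      rw [dotProduct, Complex.re_sum, Complex.one_re] at this
      rw [← this]
      refine Finset.sum_congr rfl fun s _ => ?_
      rw [Pi.star_apply, Complex.star_def, ← Complex.normSq_eq_conj_mul_self, Complex.ofReal_re,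
        Complex.normSq_eq_norm_sq]
    rw [← h1, ← Finset.sum_subset (Finset.subset_univ T)]
    intro s _ hs
    rw [hvT s hs, norm_zero, zero_pow two_ne_zero]
  have hform : (star v ⬝ᵥ (X *ᵥ v)).re = ∑ r, ‖(B *ᵥ v) r‖ ^ 2 := by
    rw [hB, ← mulVec_mulVec, dotProduct_mulVec, ← star_mulVec, dotProduct, Complex.re_sum]
    refine Finset.sum_congr rfl fun r _ => ?_
    rw [Pi.star_apply, Complex.star_def, ← Complex.normSq_eq_conj_mul_self, Complex.ofReal_re,
      Complex.normSq_eq_norm_sq]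
  have hdiag : ∀ s, (X s s).re = ∑ r, ‖B r s‖ ^ 2 := by
    intro s
    rw [hB, Matrix.mul_apply, Complex.re_sum]
    refine Finset.sum_congr rfl fun r _ => ?_
    rw [conjTranspose_apply, Complex.star_def, ← Complex.normSq_eq_conj_mul_self,
      Complex.ofReal_re, Complex.normSq_eq_norm_sq]
  -- Cauchy–Schwarz row by row
  have hrow : ∀ r, ‖(B *ᵥ v) r‖ ^ 2 ≤ ∑ s ∈ T, ‖B r s‖ ^ 2 := by
    intro r
    have hsum : (B *ᵥ v) r = ∑ s ∈ T, B r s * v s := by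
      rw [mulVec, dotProduct, ← Finset.sum_subset (Finset.subset_univ T)]
      intro s _ hs
      rw [hvT s hs, mul_zero]
    calc ‖(B *ᵥ v) r‖ ^ 2 ≤ (∑ s ∈ T, ‖B r s‖ * ‖v s‖) ^ 2 := by
          rw [hsum]
          gcongr
          exact (norm_sum_le _ _).trans (le_of_eq (Finset.sum_congr rfl fun s _ => norm_mul _ _))
      _ ≤ (∑ s ∈ T, ‖B r s‖ ^ 2) * ∑ s ∈ T, ‖v s‖ ^ 2 :=
          Finset.sum_mul_sq_le_sq_mul_sq T _ _
      _ = ∑ s ∈ T, ‖B r s‖ ^ 2 := by rw [hnormv, mul_one]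
  calc (star v ⬝ᵥ (X *ᵥ v)).re = ∑ r, ‖(B *ᵥ v) r‖ ^ 2 := hform
    _ ≤ ∑ r, ∑ s ∈ T, ‖B r s‖ ^ 2 := Finset.sum_le_sum fun r _ => hrow r
    _ = ∑ s ∈ T, ∑ r, ‖B r s‖ ^ 2 := Finset.sum_comm
    _ = ∑ s ∈ T, (X s s).re := Finset.sum_congr rfl fun s _ => (hdiag s).symm

/-- **Diagonal entries of the Gibbs weight of a nonnegative matrix are at most one**:
for `X ≥ 0` and `β ≥ 0`, `Re (e^{-βX})_{ss} ≤ 1` (spectral decomposition: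
`(e^{-βX})_{ss} = Σ_i e^{-βλ_i} |U_{si}|²` with `λ_i ≥ 0`). Bratteli–Robinson II §5.3.1. [folklore] -/
theorem re_gibbsWeight_apply_self_le_one {X : Matrix n n ℂ} (hX : X.PosSemidef) {β : ℝ}
    (hβ : 0 ≤ β) (s : n) : ((Matrix.gibbsWeight β X) s s).re ≤ 1 := by
  have hH : X.IsHermitian := hX.1
  have hs : IsSelfAdjoint X := hH.isSelfAdjoint
  have hsmul : (-(β : ℂ) • X : Matrix n n ℂ) = (-β : ℝ) • X := by
    ext i j
    simp [Matrix.smul_apply, Complex.real_smul]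
  have h1 : Matrix.gibbsWeight β X = cfc (fun x : ℝ => Real.exp ((-β) • x)) X := by
    rw [Matrix.gibbsWeight, hsmul, cfc_comp_smul (-β) Real.exp X, CFC.real_exp_eq_normedSpace_exp]
  have hU : (hH.eigenvectorUnitary : Matrix n n ℂ) * star (hH.eigenvectorUnitary : Matrix n n ℂ) =
      1 := Matrix.mem_unitaryGroup_iff.1 hH.eigenvectorUnitary.2
  have hentry : (Matrix.gibbsWeight β X) s s =
      ∑ i, (hH.eigenvectorUnitary : Matrix n n ℂ) s i *
        ((Real.exp ((-β) • hH.eigenvalues i) : ℝ) : ℂ) *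
          star ((hH.eigenvectorUnitary : Matrix n n ℂ) s i) := by
    rw [h1, hH.cfc_eq, Matrix.IsHermitian.cfc, Unitary.conjStarAlgAut_apply, Matrix.mul_apply]
    refine Finset.sum_congr rfl fun i _ => ?_
    rw [mul_diagonal, Matrix.star_apply]
    rfl
  rw [hentry, Complex.re_sum]
  have hone : ∑ i, ‖(hH.eigenvectorUnitary : Matrix n n ℂ) s i‖ ^ 2 = 1 := by
    have h := congrFun (congrFun hU s) s
    rw [Matrix.mul_apply, Matrix.one_apply_eq] at h
    have h' := congrArg Complex.re h
    rw [Complex.re_sum, Complex.one_re] at h'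
    rw [← h']
    refine Finset.sum_congr rfl fun i _ => ?_
    rw [Matrix.star_apply, Complex.star_def, Complex.mul_conj, Complex.ofReal_re,
      Complex.normSq_eq_norm_sq]
  rw [← hone]
  refine Finset.sum_le_sum fun i _ => ?_
  have hterm : ((hH.eigenvectorUnitary : Matrix n n ℂ) s i *
      ((Real.exp ((-β) • hH.eigenvalues i) : ℝ) : ℂ) *
        star ((hH.eigenvectorUnitary : Matrix n n ℂ) s i)).re =
      Real.exp ((-β) • hH.eigenvalues i) * ‖(hH.eigenvectorUnitary : Matrix n n ℂ) s i‖ ^ 2 := by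
    rw [mul_comm ((hH.eigenvectorUnitary : Matrix n n ℂ) s i), mul_assoc, Complex.star_def,
      Complex.mul_conj, ← Complex.ofReal_mul, Complex.ofReal_re, Complex.normSq_eq_norm_sq]
  rw [hterm]
  have hlam : 0 ≤ hH.eigenvalues i := hX.eigenvalues_nonneg i
  have hexp : Real.exp ((-β) • hH.eigenvalues i) ≤ 1 := by
    rw [Real.exp_le_one_iff, smul_eq_mul]
    nlinarith
  calc Real.exp ((-β) • hH.eigenvalues i) * ‖(hH.eigenvectorUnitary : Matrix n n ℂ) s i‖ ^ 2
      ≤ 1 * ‖(hH.eigenvectorUnitary : Matrix n n ℂ) s i‖ ^ 2 := by gcongr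
    _ = _ := one_mul _

end MatrixGeneric

section Sectors

variable {ι : Type*} [Fintype ι] [DecidableEq ι]

omit [Fintype ι] [DecidableEq ι] in
/-- The sector projection of a Fock vector lies in that sector. [folklore] -/
theorem isNParticle_sectorProj (v : Fock ι) (N : ℕ) :
    IsNParticle N (fun s => if s.card = N then v s else 0) := fun _ hs => if_neg hs

omit [DecidableEq ι] in
/-- A particle-number preserving matrix maps a sector into itself. [folklore] -/
theorem mulVec_sectorProj_apply_of_card_ne (M : Matrix (Finset ι) (Finset ι) ℂ)
    (hM : ∀ s t, s.card ≠ t.card → M s t = 0) (v : Fock ι) (N : ℕ) {s : Finset ι}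
    (hs : s.card ≠ N) : (M *ᵥ fun t => if t.card = N then v t else 0) s = 0 := by
  rw [mulVec, dotProduct]
  refine Finset.sum_eq_zero fun t _ => ?_
  by_cases ht : t.card = N
  · rw [hM s t (by rw [ht]; exact hs), zero_mul]
  · rw [if_neg ht, mul_zero]

omit [DecidableEq ι] in
/-- A Fock vector is the sum of its sector projections. [folklore] -/
theorem eq_sum_sectorProj (v : Fock ι) :
    v = ∑ N ∈ Finset.range (Fintype.card ι + 1), fun s => if s.card = N then v s else 0 := by
  funext s
  rw [Finset.sum_apply, Finset.sum_eq_single s.card]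
  · rw [if_pos rfl]
  · intro N _ hN; rw [if_neg (Ne.symm hN)]
  · intro h
    exact absurd (Finset.mem_range.2 (Nat.lt_succ_of_le (Finset.card_le_univ s))) h

omit [DecidableEq ι] in
/-- **Sector splitting of the quadratic form** of a particle-number preserving matrix:
`⟨v, M v⟩ = Σ_N ⟨v_N, M v_N⟩`. [folklore] -/
theorem star_dotProduct_mulVec_eq_sum_sectors (M : Matrix (Finset ι) (Finset ι) ℂ)
    (hM : ∀ s t, s.card ≠ t.card → M s t = 0) (v : Fock ι) :
    star v ⬝ᵥ (M *ᵥ v) = ∑ N ∈ Finset.range (Fintype.card ι + 1),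
      star (fun s => if s.card = N then v s else 0) ⬝ᵥ
        (M *ᵥ fun s => if s.card = N then v s else 0) := by
  conv_lhs => rw [eq_sum_sectorProj v]
  rw [star_sum, Matrix.mulVec_sum, sum_dotProduct]
  refine Finset.sum_congr rfl fun N _ => ?_
  rw [dotProduct_sum, Finset.sum_eq_single N]
  · intro N' _ hN'
    rw [dotProduct]
    refine Finset.sum_eq_zero fun s _ => ?_
    by_cases hs : s.card = N
    · rw [mulVec_sectorProj_apply_of_card_ne M hM v N' (by rw [hs]; exact Ne.symm hN'), mul_zero]
    · rw [Pi.star_apply, if_neg hs, star_zero, zero_mul]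
  · intro h; exact absurd (by assumption) h

/-- A diagonal real weight depending only on the particle number contributes `-m(N) ‖v_N‖²` on
the `N`-sector. [folklore] -/
theorem re_rayleigh_diagonal_card {m : ℕ → ℝ} {N : ℕ} {φ : Fock ι} (hφ : IsNParticle N φ) :
    (star φ ⬝ᵥ ((diagonal fun s : Finset ι => ((-m s.card : ℝ) : ℂ)) *ᵥ φ)).re =
      -m N * normSq φ := by
  rw [dotProduct, Complex.re_sum, normSq, Finset.mul_sum]
  refine Finset.sum_congr rfl fun s _ => ?_
  rw [mulVec_diagonal, Pi.star_apply]
  by_cases hs : s.card = N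
  · rw [hs, mul_comm, mul_assoc, Complex.star_def, Complex.mul_conj, ← Complex.ofReal_mul,
      Complex.ofReal_re, Complex.normSq_eq_norm_sq]
  · rw [hφ s hs]; simp

/-- **Sector lower bounds make `H + diag(-m(|s|))` a nonnegative form.** If `H` preserves the
particle number and `Re ⟨φ, H φ⟩ ≥ m(N) ‖φ‖²` on every `N`-sector, then
`Re ⟨v, (H + diag(-m)) v⟩ ≥ 0` for every `v`. [folklore] -/
theorem re_rayleigh_add_diagonal_nonneg (H : Matrix (Finset ι) (Finset ι) ℂ)
    (hH : ∀ s t, s.card ≠ t.card → H s t = 0) (m : ℕ → ℝ)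
    (hm : ∀ (N : ℕ) (φ : Fock ι), IsNParticle N φ → m N * normSq φ ≤ (star φ ⬝ᵥ (H *ᵥ φ)).re)
    (v : Fock ι) :
    0 ≤ (star v ⬝ᵥ ((H + diagonal fun s : Finset ι => ((-m s.card : ℝ) : ℂ)) *ᵥ v)).re := by
  have hM : ∀ s t, s.card ≠ t.card →
      (H + diagonal fun s : Finset ι => ((-m s.card : ℝ) : ℂ)) s t = 0 := by
    intro s t hst
    rw [Matrix.add_apply, hH s t hst, diagonal_apply_ne _ (fun h => hst (by rw [h])), add_zero]
  rw [star_dotProduct_mulVec_eq_sum_sectors _ hM v, Complex.re_sum]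
  refine Finset.sum_nonneg fun N _ => ?_
  have hφ := isNParticle_sectorProj v N
  rw [add_mulVec, dotProduct_add, Complex.add_re, re_rayleigh_diagonal_card hφ]
  have := hm N _ hφ
  linarith

end Sectors

section Hubbard

variable {Λ : Type*} [LinearOrder Λ] [Fintype Λ] (G : SimpleGraph Λ) [DecidableRel G.Adj]

/-- The Hubbard Hamiltonian is block diagonal in the particle number. [folklore] -/
theorem hamiltonian_apply_eq_zero_of_card_ne (t U : ℝ) (s s' : Finset (Orb Λ))
    (h : s.card ≠ s'.card) : hamiltonian G t U s s' = 0 := by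
  by_contra hne
  have hp := LiebThm1.preservesSectors_hamiltonian G t U s s' hne
  exact h (by rw [card_eq_upPart_add_downPart, hp.1, hp.2, ← card_eq_upPart_add_downPart])

/-- **The parity-twisted grand-canonical partition function as a sector sum**:
`Tr[P e^{-β(H - μN)}] = Σ_s (-1)^{|s|} e^{βμ|s|} (e^{-βH})_{ss}` (`[H, N] = 0`, `N` and `P`
diagonal in the occupation basis). Bratteli–Robinson II §5.3.1. [folklore] -/
theorem parity_trace_eq_sum (U μ β : ℝ) :
    (parityOp * Matrix.gibbsWeight β (hamiltonianWith G 1 U μ)).trace =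
      ∑ s : Finset (Orb Λ), (-1 : ℂ) ^ s.card * (Complex.exp ((β * μ * s.card : ℝ) : ℂ) *
        (Matrix.gibbsWeight β (hamiltonian G 1 U)) s s) := by
  have hcomm : Commute (hamiltonian G 1 U) totalNumber := by
    simpa using hamiltonianWith_commute_totalNumber G 1 U 0
  have hsplit : -(β : ℂ) • hamiltonianWith G 1 U μ =
      -(β : ℂ) • hamiltonian G 1 U + ((β : ℂ) * μ) • totalNumber := by
    rw [hamiltonianWith_eq, smul_sub, smul_smul, sub_eq_add_neg, ← neg_smul, neg_mul, neg_neg]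
  have hc : Commute (-(β : ℂ) • hamiltonian G 1 U) (((β : ℂ) * μ) • totalNumber) :=
    (hcomm.smul_left _).smul_right _
  have hN : ((β : ℂ) * μ) • (totalNumber : Matrix (Finset (Orb Λ)) (Finset (Orb Λ)) ℂ) =
      diagonal fun s => (β : ℂ) * μ * (s.card : ℂ) := by
    rw [totalNumber_eq_diagonal_card, ← diagonal_smul]
    rfl
  rw [Matrix.gibbsWeight, hsplit, Matrix.exp_add_of_commute _ _ hc, hN, Matrix.exp_diagonal,
    ← Matrix.gibbsWeight, parityOp, trace]
  simp only [diag_apply, diagonal_mul, mul_diagonal]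
  refine Finset.sum_congr rfl fun s _ => ?_
  rw [Pi.coe_exp, ← Complex.exp_eq_exp_ℂ]
  push_cast
  ring

/-- **The vacuum entry of the Gibbs weight is one**: `(e^{-βH})_{∅∅} = 1` (`H|∅⟩ = 0`). [folklore] -/
theorem gibbsWeight_apply_empty_empty (U β : ℝ) :
    (Matrix.gibbsWeight β (hamiltonian G 1 U)) ∅ ∅ = 1 := by
  have h0 : (-(β : ℂ) • hamiltonian G 1 U) *ᵥ (vacuum : Fock (Orb Λ)) = 0 := by
    rw [smul_mulVec, hamiltonian_mulVec_vacuum, smul_zero]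
  have h := exp_mulVec_eq_self_of_mulVec_eq_zero _ _ h0
  have h' := congrFun h ∅
  rw [vacuum, mulVec_single_one, col_apply, Pi.single_eq_same] at h'
  exact h'

end Hubbard

end Literature.MathematicalPhysics.QuantumLattice.HubbardBandBottom
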